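import Summits.Ventures.HSemireg.WedgeHankelRecurrenceGaussConvergentsMonotone

/-!
# Venture HSemireg — **REVERSING THE RECURRENCE COEFFICIENTS DOES NOT CHANGE `q_{m+1}`** (`A_i = a_{m−i}`, `B_i = b_{m+1−i}`: the Jacobi matrix is replaced by the transpose of its
# persymmetric flip, N293, whose characteristic polynomial is the same); consequently the interlacing theorem for a change of the LAST diagonal coefficient (N333) transfers to a change of the
# FIRST one: if `a_0` is replaced by `a_0 + c`, `c > 0`, the new zeros `ỹ` of `q̃_{n+2}` satisfy `x_k < ỹ_k < x_{k+1}`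

HONEST FRAMING. Part of the Lean index of the computation cell `pub-hsemireg` (seat p10 gen 44, Sunday typer «UNIFORM-IN-n»).  Real polynomials and square real matrices (`Matrix.charpoly`,
`charpoly_transpose`) only; no variety, no cohomology theory, no sheaf, no Ext group and no semiregularity map is constructed here; nothing here says that HC / HC_CM / HC_AV holds; no Literature
fact (unproved `Prop`) is declared or used.  Custodian versions as in `WedgeHankelSiegelIdeal` (1/3).
SOURCES (cited).  G. H. Golub, SIAM Review 15 (1973) 318–334 §5; J. H. Wilkinson, *The Algebraic Eigenvalue Problem* (1965) Ch. 5 §§36–40 (the persymmetric flip of a tridiagonal matrix);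
B. N. Parlett, *The Symmetric Eigenvalue Problem* (1980) §7-7; T. S. Chihara, *An Introduction to Orthogonal Polynomials* Ch. III (associated ∕ reversed recurrences).
PROOF TYPED HERE.  `q_{m+1} = charpoly R` with `R` the flipped matrix (N293 `charpoly_revJacobi`), `R = Jᵀ` for the Jacobi matrix `J` of the reversed coefficients (entrywise case analysis),
`charpoly Jᵀ = charpoly J = Q_{m+1}` (Mathlib `Matrix.charpoly_transpose`, N293 `charpoly_jacobi`).  For the first coefficient: the reversed families of `q` and `q̃` agree up to level `n + 1`
(N292 `recurrence_agree_of_coeff_agree`) and differ at the top by `−c Q_{n+1}`, so N333 applies.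
DEDUP DISCLOSURE (`rg -n 'revJacobi|reversed|charpoly_transpose' Summits/Ventures/HSemireg`, 2026-09-03): N293 has both characteristic-polynomial identities; the reversal statement and the
first-coefficient interlacing are new.  The 3 names below: 0 hits tree-wide.

WHAT IS IN THE TREE.  N293 `charpoly_revJacobi`, `charpoly_jacobi`; N292 `exists_recurrence_solution`, `recurrence_agree_of_coeff_agree`; N333 `top_perturbation_interlace`; N294
`strictMono_eq_of_prod_X_sub_C_eq`; N279 `recurrence_zeros_interlace`; Mathlib `Matrix.charpoly_transpose`.
THIS FILE (namespace `Summit.Ventures.HSemireg.Wedge.HankelOuter` continued; CHAINED on N337 (import only); 0 definitions):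
* §1103 **`recurrence_reverse_top_eq`** (`Q_{m+1} = q_{m+1}` for the reversed coefficients), `recurrence_first_coeff_shift_top` (for `ã_0 = a_0 + c`: `q̃_{n+2} = Q_{n+2} − C c·Q_{n+1}` with
  `Q` the reversal of `q` at level `n + 1`, and `Q_{n+2} = q_{n+2}`), **`first_perturbation_interlace`** (`c > 0`: the zeros of `q_{n+2}` and `q̃_{n+2}` satisfy `x_k < ỹ_k < x_{k+1}`).
CAVEATS.  Positive recurrences for the interlacing; the reversal identity itself needs no positivity.  Nothing Ext-side.  New names only.
-/

open Module Polynomial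
open scoped Matrix Polynomial

namespace Summit.Ventures.HSemireg.Wedge.HankelOuter

/-! ## §1103. The reversed recurrence; perturbing the first diagonal coefficient -/

/-- **REVERSAL: if `A_i = a_{m−i}` (`i ≤ m`) and `B_i = b_{m+1−i}` (`1 ≤ i ≤ m`) then `Q_{m+1} = q_{m+1}`.** [Wilkinson Ch. 5 §36; Parlett §7-7; this file, §1103] -/
theorem recurrence_reverse_top_eq {q Q : ℕ → ℝ[X]} {a b A B : ℕ → ℝ} (hq0 : q 0 = 1) (hq1 : q 1 = Polynomial.X - C (a 0))
    (hrec : ∀ n, q (n + 2) = (Polynomial.X - C (a (n + 1))) * q (n + 1) - C (b (n + 1)) * q n)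
    (hQ0 : Q 0 = 1) (hQ1 : Q 1 = Polynomial.X - C (A 0)) (hQrec : ∀ n, Q (n + 2) = (Polynomial.X - C (A (n + 1))) * Q (n + 1) - C (B (n + 1)) * Q n)
    (m : ℕ) (hA : ∀ i, i ≤ m → A i = a (m - i)) (hB : ∀ i, 1 ≤ i → i ≤ m → B i = b (m + 1 - i)) : Q (m + 1) = q (m + 1) := by
  classical
  -- the Jacobi matrix of the reversed coefficients and the flipped matrix of the original ones
  set J : Matrix (Fin (m + 1)) (Fin (m + 1)) ℝ := Matrix.of fun i j : Fin (m + 1) =>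
    if (i : ℕ) = j then A i else if (j : ℕ) = i + 1 then 1 else if (i : ℕ) = j + 1 then B i else 0 with hJdef
  have hJ : ∀ i j : Fin (m + 1), J i j = if (i : ℕ) = j then A i else if (j : ℕ) = i + 1 then 1 else if (i : ℕ) = j + 1 then B i else 0 := fun i j => by
    rw [hJdef, Matrix.of_apply]
  have hR : ∀ i j : Fin (m + 1), Jᵀ i j = if (i : ℕ) = j then a (m - i) else if (j : ℕ) = i + 1 then b (m - i) else if (i : ℕ) = j + 1 then 1 else 0 := by
    intro i j
    rw [Matrix.transpose_apply, hJ]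
    have hi := i.is_lt
    have hj := j.is_lt
    by_cases h1 : (i : ℕ) = j
    · rw [if_pos h1.symm, if_pos h1, hA j (by omega), ← h1]
    · rw [if_neg (Ne.symm h1), if_neg h1]
      by_cases h2 : (j : ℕ) = i + 1
      · rw [if_neg (show ¬ ((i : ℕ) = j + 1) by omega), if_pos h2, if_pos h2, hB j (by omega) (by omega)]
        congr 1; omega
      · rw [if_neg h2, if_neg h2]
  rw [← charpoly_jacobi hQ0 hQ1 hQrec hJ, ← charpoly_revJacobi hq0 hq1 hrec m Jᵀ hR, Matrix.charpoly_transpose]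

/-- **Changing the FIRST coefficient, read through the reversal**: for `ã_0 = a_0 + c`, `ã_i = a_i` (`i ≥ 1`) and the reversal `Q` of `q` at level `n + 1` (`A_i = a_{n+1−i}`, `B_i = b_{n+2−i}`),
`q_{n+2} = Q_{n+2}` and `q̃_{n+2} = Q_{n+2} − C c · Q_{n+1}`. [this file, §1103] -/
theorem recurrence_first_coeff_shift_top {q q' Q : ℕ → ℝ[X]} {a a' b A B : ℕ → ℝ} (hq0 : q 0 = 1) (hq1 : q 1 = Polynomial.X - C (a 0))
    (hrec : ∀ n, q (n + 2) = (Polynomial.X - C (a (n + 1))) * q (n + 1) - C (b (n + 1)) * q n)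
    (hq0' : q' 0 = 1) (hq1' : q' 1 = Polynomial.X - C (a' 0)) (hrec' : ∀ n, q' (n + 2) = (Polynomial.X - C (a' (n + 1))) * q' (n + 1) - C (b (n + 1)) * q' n)
    (hQ0 : Q 0 = 1) (hQ1 : Q 1 = Polynomial.X - C (A 0)) (hQrec : ∀ n, Q (n + 2) = (Polynomial.X - C (A (n + 1))) * Q (n + 1) - C (B (n + 1)) * Q n)
    (n : ℕ) {c : ℝ} (ha0 : a' 0 = a 0 + c) (ha : ∀ i, 1 ≤ i → a' i = a i)
    (hA : ∀ i, i ≤ n + 1 → A i = a (n + 1 - i)) (hB : ∀ i, 1 ≤ i → i ≤ n + 1 → B i = b (n + 2 - i)) :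
    q (n + 2) = Q (n + 2) ∧ q' (n + 2) = Q (n + 2) - C c * Q (n + 1) := by
  -- the reversal of `q'` at level `n + 1`
  obtain ⟨Q', hQ'0, hQ'1, hQ'rec⟩ := exists_recurrence_solution (fun i => a' (n + 1 - i)) (fun i => b (n + 2 - i)) 1 (Polynomial.X - C (a' (n + 1 - 0)))
  have hrevq : Q (n + 2) = q (n + 2) :=
    recurrence_reverse_top_eq hq0 hq1 hrec hQ0 hQ1 hQrec (n + 1) hA (fun i hi hi' => by rw [hB i hi hi'])
  have hrevq' : Q' (n + 2) = q' (n + 2) :=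
    recurrence_reverse_top_eq (A := fun i => a' (n + 1 - i)) (B := fun i => b (n + 2 - i)) hq0' hq1' hrec' hQ'0 hQ'1 hQ'rec (n + 1) (fun i _ => rfl) (fun i _ _ => rfl)
  -- `Q'` agrees with `Q` up to level `n + 1`
  have hagree : ∀ k, k ≤ n + 1 → Q' k = Q k := by
    refine recurrence_agree_of_coeff_agree (a := A) (b := B) (a' := fun i => a' (n + 1 - i)) (b' := fun i => b (n + 2 - i)) (q := Q) (q' := Q')
      (by rw [hQ'0, hQ0]) ?_ hQrec hQ'rec (N := n) (fun k hk hk' => ?_) (fun k hk hk' => ?_)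
    · rw [hQ'1, hQ1, hA 0 (by omega), Nat.sub_zero, ha (n + 1) (by omega)]
    · show a' (n + 1 - k) = A k
      rw [hA k (by omega), ha (n + 1 - k) (by omega)]
    · show b (n + 2 - k) = B k
      rw [hB k hk (by omega)]
  refine ⟨hrevq.symm, ?_⟩
  rw [← hrevq', hQ'rec n, hagree (n + 1) le_rfl, hagree n (by omega), hQrec n, hA (n + 1) le_rfl, hB (n + 1) (by omega) le_rfl]
  simp only [Nat.sub_self, show n + 1 + 1 - (n + 1) = 1 by omega, ha0, C_add]
  ring

/-- **STRICT INTERLACING UNDER A POSITIVE CHANGE OF THE FIRST DIAGONAL COEFFICIENT**: `ã_0 = a_0 + c` (`c > 0`), `ã_i = a_i` (`i ≥ 1`), same `b > 0`; then the zeros `x` of `q_{n+2}` and `ỹ` of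
`q̃_{n+2}` satisfy `x_k < ỹ_k` for all `k` and `ỹ_k < x_{k+1}` for `k ≤ n`. [Golub 1973 §5; Wilkinson Ch. 2 §40; this file, §1103] -/
theorem first_perturbation_interlace {q q' : ℕ → ℝ[X]} {a a' b : ℕ → ℝ} (hq0 : q 0 = 1) (hq1 : q 1 = Polynomial.X - C (a 0))
    (hrec : ∀ n, q (n + 2) = (Polynomial.X - C (a (n + 1))) * q (n + 1) - C (b (n + 1)) * q n)
    (hq0' : q' 0 = 1) (hq1' : q' 1 = Polynomial.X - C (a' 0)) (hrec' : ∀ n, q' (n + 2) = (Polynomial.X - C (a' (n + 1))) * q' (n + 1) - C (b (n + 1)) * q' n)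
    (hb : ∀ j, 0 < b j) (n : ℕ) {c : ℝ} (hc : 0 < c) (ha0 : a' 0 = a 0 + c) (ha : ∀ i, 1 ≤ i → a' i = a i)
    {x y : Fin (n + 2) → ℝ} (hx : StrictMono x) (hxq : q (n + 2) = ∏ k, (Polynomial.X - C (x k))) (hy : StrictMono y) (hyq : q' (n + 2) = ∏ k, (Polynomial.X - C (y k))) :
    (∀ k, x k < y k) ∧ ∀ k : Fin (n + 1), y k.castSucc < x k.succ := by
  -- the reversal `Q` of `q` at level `n + 1`, with positive `B`
  obtain ⟨Q, hQ0, hQ1, hQrec⟩ := exists_recurrence_solution (fun i => a (n + 1 - i)) (fun i => if i ≤ n + 1 then b (n + 2 - i) else 1) 1 (Polynomial.X - C (a (n + 1 - 0)))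
  have hBpos : ∀ j, 0 < (fun i => if i ≤ n + 1 then b (n + 2 - i) else (1 : ℝ)) j := fun j => by
    simp only; split_ifs
    · exact hb _
    · exact one_pos
  obtain ⟨h1, h2⟩ := recurrence_first_coeff_shift_top (A := fun i => a (n + 1 - i)) (B := fun i => if i ≤ n + 1 then b (n + 2 - i) else 1)
    hq0 hq1 hrec hq0' hq1' hrec' hQ0 hQ1 hQrec n ha0 ha (fun i _ => rfl) (fun i _ hi' => by simp only [if_pos hi'])
  obtain ⟨z, X', Y', hz, hX', hY', hzq, hX'q, hY'q, hlt, hint⟩ :=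
    top_perturbation_interlace (a := fun i => a (n + 1 - i)) (b := fun i => if i ≤ n + 1 then b (n + 2 - i) else 1) hQ0 hQ1 hQrec hBpos n hc
  have hXx : X' = x := strictMono_eq_of_prod_X_sub_C_eq hX' hx (hX'q.symm.trans (h1.symm.trans hxq))
  have hYy : Y' = y := strictMono_eq_of_prod_X_sub_C_eq hY' hy (hY'q.symm.trans (h2.symm.trans hyq))
  subst hXx hYy
  exact ⟨hlt, fun k => (hint k).1.trans (hint k).2⟩

end Summit.Ventures.HSemireg.Wedge.HankelOuter
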